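/-
Origin: expansion seat `planner-pub-hodgecm-pohl-g6-0`, handover #2 2026-08-18T06:07:10Z (`HOME/pub-hodgecm-pohl-g6/lean/Pohl6/DegreeZeroOrderFree.lean`, md5 d6c0ccbd, 65 lines);
landed by the gen-6 packager in gate run 24 as `HodgeCM/Proofs/Pohlmann/DegreeZeroOrderFree.lean` (import ^import Pohl6\.→import HodgeCM.Proofs.Pohlmann. ×1).
-/
/-
Copyright (c) 2026. All rights reserved.
Released under Apache 2.0 license as described in the file LICENSE.
Origin: expansion seat `planner-pub-hodgecm-pohl-g6-0` (unit pub-hodgecm-pohl-g6, part (b) `PohlmannSpan`, generation 6).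
Proposed place: `HodgeCM/Proofs/Pohlmann/DegreeZeroOrderFree.lean` (module `HodgeCM.Proofs.Pohlmann.DegreeZeroOrderFree`).
Imports: the run-23 module `HodgeCM.Literature.GaoUllmoOrderFree` and this seat's `DegreeZeroGeneric` (WIP import
`Pohl6.DegreeZeroGeneric`, to be rewritten `HodgeCM.Proofs.Pohlmann.DegreeZeroGeneric`).
-/
import Summits.HodgeConjecture.HodgeCM.Literature.GaoUllmoOrderFree
import Summits.HodgeConjecture.HodgeCM.Proofs.Pohlmann.DegreeZeroGeneric

/-!
# Cross-model count of Hodge classes, every `p ≥ 0`, without the ordering convention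

`DegreeZeroCrossModel.lean` (pohl-g5) equates the package's `dim_ℚ B^p(∏_j A_{(F,Θ_j)})` with `dim_ℚ B^p` of Gao–Ullmo's
exterior-algebra model for every `p ≥ 0`, under Gao–Ullmo's ordering convention `OrderConvention (piCMType Θ)` on
`Hom(F^{n+1}, ℂ)`; `GaoUllmoOrderFree.lean` (cf-gaoullmo-g3) drops that convention for `p ≥ 1`
(`finrank_hodgeClassesOf_eq_finrank_Bp'`, from the order-free `GaoUllmo.finrank_Bp_pi_eq_card_hodgeWeight'`, which holds for
every `p`).  This file records the common refinement — every `p ≥ 0`, any linear order — once over the named degree-`0`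
residual `CMProdConnected` and once over the typed input `Fact_H0_rank` of `DegreeZeroGeneric.lean` [Gao–Ullmo, *J. Inst. Math.
Jussieu* 25 (2025) 215–249 = arXiv:2411.12249, Thm 3.1 "(Pohlmann) … For each `p ≥ 0` … In particular `dim_ℚ B^p(A)` is the
number of ordered `P` … with `|P| = 2p` satisfying (3.2)", p. 9 ll. 32–40].  Kernel corollaries; nothing cited or posited here.
-/

noncomputable section

namespace HodgeCM

namespace Universe

open Literature.AlgebraicGeometry.Motives (CMType)
open HodgeCM.GaoUllmo

variable {U : Universe}

/-- **Cross-model count, every `p ≥ 0`, any linear order on `Hom(F^{n+1}, ℂ)`**: under `ModelAxioms` + N1–N4 +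
`CMProdConnected`, for `F` Galois CM, `dim_ℚ B^p(∏_j A_{(F,Θ_j)})` of the abstract universe equals `dim_ℚ B^p` of Gao–Ullmo's
model `⋀^{2p} ℚ^{Hom(F^{n+1},ℂ)}` (both are the number of Hodge weights: `finrank_hodgeClassesOf_all`,
`GaoUllmo.finrank_Bp_pi_eq_card_hodgeWeight'`). -/
theorem finrank_hodgeClassesOf_eq_finrank_Bp_all' (M : U.ModelAxioms) (hN1 : U.Fact_cupExterior) (hN2 : U.Fact_cup_hodge)
    (hN3 : U.Fact_pull_H0) (hN4 : U.Fact_hodge_F0) (h0 : U.CMProdConnected) (F : CMField) [IsGalois ℚ F] {n : ℕ}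
    (Θ : Fin (n + 1) → CMType F) [LinearOrder (Emb (Fin (n + 1) → (F : Type)))] (p : ℕ) :
    Module.finrank ℚ (U.hodgeClassesOf (U.cmProd F Θ) p) = Module.finrank ℚ (Bp (piCMType Θ) p) := by
  rw [finrank_hodgeClassesOf_all (F := F) (n := n) (Θ := Θ) M hN1 hN2 hN3 hN4 h0 p, finrank_Bp_pi_eq_card_hodgeWeight' Θ p]

/-- The same over the typed degree-`0` input `Fact_H0_rank` (`dim_ℚ H⁰(X, ℚ) = 1` for every variety of the universe). -/
theorem finrank_hodgeClassesOf_eq_finrank_Bp_all_of_H0_rank (M : U.ModelAxioms) (hN1 : U.Fact_cupExterior)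
    (hN2 : U.Fact_cup_hodge) (hN3 : U.Fact_pull_H0) (hN4 : U.Fact_hodge_F0) (h0 : U.Fact_H0_rank) (F : CMField)
    [IsGalois ℚ F] {n : ℕ} (Θ : Fin (n + 1) → CMType F) [LinearOrder (Emb (Fin (n + 1) → (F : Type)))] (p : ℕ) :
    Module.finrank ℚ (U.hodgeClassesOf (U.cmProd F Θ) p) = Module.finrank ℚ (Bp (piCMType Θ) p) :=
  finrank_hodgeClassesOf_eq_finrank_Bp_all' M hN1 hN2 hN3 hN4 (cmProdConnected_of_H0_rank h0) F Θ p

/-- The same on the F6-free generic cone, over the residual `CMProdH0Nontrivial` (`H⁰(∏_j A_{(F,Θ_j)}) ≠ 0`). -/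
theorem finrank_hodgeClassesOf_eq_finrank_Bp_all_of_generic (M : U.ModelAxioms) (hN1 : U.Fact_cupExterior)
    (hN2 : U.Fact_cup_hodge) (hN3 : U.Fact_pull_H0) (hN4 : U.Fact_hodge_F0) (h7 : U.Fact_gysin) (ht : U.Fact_trTopCM)
    (hnt : U.CMProdH0Nontrivial) (F : CMField) [IsGalois ℚ F] {n : ℕ} (Θ : Fin (n + 1) → CMType F)
    [LinearOrder (Emb (Fin (n + 1) → (F : Type)))] (p : ℕ) :
    Module.finrank ℚ (U.hodgeClassesOf (U.cmProd F Θ) p) = Module.finrank ℚ (Bp (piCMType Θ) p) :=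
  finrank_hodgeClassesOf_eq_finrank_Bp_all' M hN1 hN2 hN3 hN4 (cmProdConnected_of_generic M hN1 hN3 h7 ht hnt) F Θ p

end Universe

end HodgeCM

end
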